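import Literature.Probability.Percolation.ConditionalPositiveAssociationProofs
import Literature.Probability.Percolation.TwoClusterConditionalAssociation
import Literature.Probability.Percolation.KozmaNitzanPreFKG
import HarnessLib

/-!
# PATTERN TRANSFER: the first-in-rank patterns of the ranked surplus satisfy the surplus-transfer inequality (constant 1)

Support file (`--supports stmt-CriticalPhenomena-4575`), prover seat `prim-rate-mine-2` (lane prim-rate, constants-miner (c), BENCH row
M2-R32; `run/shared/lean/prim/prim-rate/prim-rate-mine-2/PROOFS.md` §P31).  No definitions, no named facts, no sorries; standard axioms.

For a relay set `T` ranked by `r`, the PATTERN of a relay `a` seen from `u` is `P^u_a = {u ↔ a} ∩ ⋂_{t ∈ T, r t < r a} {u ↮ t}` ("`a` is the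
first-ranked relay of the cluster of `u`") — verbatim the pattern inside `CSH.surplus`.  For ANY weights, ANY rank (no functional, no
compatibility), `a ∈ T` arbitrary and `v ∉ T`:

* `CSH.pattern_transfer` — **`μ({v ↮ T} ∩ {o ↔ v}) · μ(P^v_a) ≤ μ(v ↮ T) · μ(P^o_a)`**
  («P(o's first relay is a) · P(v avoids T) ≥ P(v's first relay is a) · P(o ↔ v, v avoids T)»).

Proof (PROOFS §P31): with `D = {v ↮ T_{<a}}` and `S = T_{≥a}`, `{v ↮ T} = D ∩ {v ↮ S}`, `P^v_a = D ∩ {v ↔ a}` and `P^v_a ∩ {o ↔ v} ⊆ P^o_a`;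
van den Berg–Häggström–Kahn's Theorem 1.3 given `D` (tree `BHK2006_clusterConditionalPositiveAssociation_holds`) for the increasing cluster
functions `1{o ∈ C_v}`, `1{a ∈ C_v}`, and its antitone form for `1{o ∈ C_v}`, `1{C_v ∩ S = ∅}`; chain the two and cancel `μ(D)`.
With the rigidity theorem of row M2-R31 this yields the functional-free strictness certificate of PROOFS §P31 (first-ranked relay).
[cite: VandenbergHaggstromKahn2005, Thm. 1.3 (p. 6)] [cite: KozmaNitzan2024, Conj. 4 (p. 32)]
-/

noncomputable section

namespace Summit.CriticalPhenomena.PercolationContinuityZ3.Theorems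

open MeasureTheory Set Literature.Probability.LatticeModels Literature.Probability.Percolation
open scoped Classical

namespace CSH

universe u

variable {V : Type u} [Fintype V]

omit [Fintype V] in
/-- The product of two `{0,1}`-indicators is the indicator of the intersection (pointwise). [folklore] -/
theorem indicator_one_mul_indicator_one (A B : Set (BondConfig V)) (ω : BondConfig V) :
    A.indicator (1 : BondConfig V → ℝ) ω * B.indicator (1 : BondConfig V → ℝ) ω = (A ∩ B).indicator (1 : BondConfig V → ℝ) ω := by
  by_cases hA : ω ∈ A <;> by_cases hB : ω ∈ B <;> simp [hA, hB]

/-- **PATTERN TRANSFER.**  Any weights `w`, any relay set `T` and rank `r`, any `a ∈ T` (in fact any `a`), observers `o` and `v ∉ T`: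
`μ({v ↮ T} ∩ {o ↔ v}) · μ(P^v_a) ≤ μ(v ↮ T) · μ(P^o_a)` with `P^u_a = {u ↔ a} ∩ ⋂_{t ∈ T, r t < r a} {u ↮ t}` the first-in-rank pattern of
`CSH.surplus`. [cite: VandenbergHaggstromKahn2005, Thm. 1.3 (p. 6)] [cite: KozmaNitzan2024, Conj. 4 (p. 32)] -/
theorem pattern_transfer (w : Sym2 V → unitInterval) (T : Finset V) (r : V → ℕ) (a o v : V) (hvT : v ∉ T) :
    (prodBernoulli w).real ({ω : BondConfig V | ∀ t ∈ T, ¬ (openGraph ω).Reachable v t} ∩ openConn o v) *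
        (prodBernoulli w).real (openConn v a ∩ ⋂ t ∈ T.filter (fun t => r t < r a), (openConn v t)ᶜ : Set (BondConfig V)) ≤
      (prodBernoulli w).real {ω : BondConfig V | ∀ t ∈ T, ¬ (openGraph ω).Reachable v t} *
        (prodBernoulli w).real (openConn o a ∩ ⋂ t ∈ T.filter (fun t => r t < r a), (openConn o t)ᶜ : Set (BondConfig V)) := by
  set μ := prodBernoulli w with hμ
  -- the lower relays `X = T_{<a}` and the conditioning event `D = {v ↮ X}`; the upper relays and their avoidance event
  set X : Set V := {t | t ∈ T ∧ r t < r a} with hX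
  set D : Set (BondConfig V) := {ω : BondConfig V | ∀ x ∈ X, ¬ (openGraph ω).Reachable v x} with hD
  set Sav : Set (BondConfig V) := {ω : BondConfig V | ∀ t ∈ T, r a ≤ r t → ¬ (openGraph ω).Reachable v t} with hSav
  set Ovo : Set (BondConfig V) := openConn v o with hOvo
  set Ova : Set (BondConfig V) := openConn v a with hOva
  have hvX : v ∉ X := fun h => hvT h.1
  have hn : ∀ S : Set (BondConfig V), 0 ≤ μ.real S := fun _ => measureReal_nonneg
  -- set identities
  have hT : {ω : BondConfig V | ∀ t ∈ T, ¬ (openGraph ω).Reachable v t} = D ∩ Sav := by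
    ext ω
    simp only [hD, hSav, hX, mem_inter_iff, mem_setOf_eq]
    constructor
    · intro h
      exact ⟨fun x hx => h x hx.1, fun t ht _ => h t ht⟩
    · rintro ⟨h1, h2⟩ t ht
      rcases lt_or_ge (r t) (r a) with hlt | hge
      · exact h1 t ⟨ht, hlt⟩
      · exact h2 t ht hge
  have hOov : (openConn o v : Set (BondConfig V)) = Ovo := by
    ext ω
    exact ⟨fun h => SimpleGraph.Reachable.symm h, fun h => SimpleGraph.Reachable.symm h⟩
  have hPv : (openConn v a ∩ ⋂ t ∈ T.filter (fun t => r t < r a), (openConn v t)ᶜ : Set (BondConfig V)) = D ∩ Ova := by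
    ext ω
    simp only [hD, hX, hOva, mem_inter_iff, mem_iInter, mem_compl_iff, Finset.mem_filter, mem_setOf_eq, openConn]
    constructor
    · rintro ⟨h1, h2⟩
      exact ⟨fun x hx => h2 x ⟨hx.1, hx.2⟩, h1⟩
    · rintro ⟨h1, h2⟩
      exact ⟨h2, fun x hx => h1 x ⟨hx.1, hx.2⟩⟩
  have hincl : D ∩ Ova ∩ Ovo ⊆ (openConn o a ∩ ⋂ t ∈ T.filter (fun t => r t < r a), (openConn o t)ᶜ : Set (BondConfig V)) := by
    intro ω hω
    simp only [hD, hX, hOva, hOvo, mem_inter_iff, mem_setOf_eq, openConn] at hω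
    obtain ⟨⟨h1, h2⟩, h3⟩ := hω
    simp only [mem_inter_iff, mem_iInter, mem_compl_iff, Finset.mem_filter, openConn, mem_setOf_eq]
    refine ⟨h3.symm.trans h2, fun t ht hot => h1 t ⟨ht.1, ht.2⟩ (h3.trans hot)⟩
  -- (1) vdBHK Thm 1.3 given `D`: `1{o ∈ C_v}` and `1{a ∈ C_v}` are positively correlated
  have hFo : ∀ ω : BondConfig V, connIndicatorFn v o (openEdgeCluster ω v) = Ovo.indicator (1 : BondConfig V → ℝ) ω :=
    fun ω => connIndicatorFn_openEdgeCluster ω v o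
  have hFa : ∀ ω : BondConfig V, connIndicatorFn v a (openEdgeCluster ω v) = Ova.indicator (1 : BondConfig V → ℝ) ω :=
    fun ω => connIndicatorFn_openEdgeCluster ω v a
  have h1 : μ.real (D ∩ Ovo) * μ.real (D ∩ Ova) ≤ μ.real D * μ.real (D ∩ (Ovo ∩ Ova)) := by
    have key := BHK2006_clusterConditionalPositiveAssociation_holds V w v X (connIndicatorFn v o) (connIndicatorFn v a)
      (monotone_connIndicatorFn v o) (monotone_connIndicatorFn v a) hvX
    simp_rw [hFo, hFa, indicator_one_mul_indicator_one] at key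
    rw [KNPreFKG.setIntegral_indicator_one_eq μ D Ovo, KNPreFKG.setIntegral_indicator_one_eq μ D Ova,
      KNPreFKG.setIntegral_indicator_one_eq μ D (Ovo ∩ Ova)] at key
    exact key
  -- (2) the antitone form: `1{o ∈ C_v}` and `1{C_v ∩ T_{≥a} = ∅}` are negatively correlated given `D`
  set G : Set (Sym2 V) → ℝ := fun C => if (∀ t ∈ T, r a ≤ r t → ¬ (t = v ∨ ∃ e ∈ C, t ∈ e)) then 1 else 0 with hGdef
  have hG : Antitone G := by
    intro C C' hCC'
    simp only [hGdef]
    by_cases h : ∀ t ∈ T, r a ≤ r t → ¬ (t = v ∨ ∃ e ∈ C', t ∈ e)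
    · have h' : ∀ t ∈ T, r a ≤ r t → ¬ (t = v ∨ ∃ e ∈ C, t ∈ e) := fun t ht hle hh =>
        h t ht hle (hh.imp id fun ⟨e, he, hte⟩ => ⟨e, hCC' he, hte⟩)
      rw [if_pos h, if_pos h']
    · rw [if_neg h]
      split_ifs <;> norm_num
  have hGω : ∀ ω : BondConfig V, G (openEdgeCluster ω v) = Sav.indicator (1 : BondConfig V → ℝ) ω := by
    intro ω
    have hiff : (∀ t ∈ T, r a ≤ r t → ¬ (t = v ∨ ∃ e ∈ openEdgeCluster ω v, t ∈ e)) ↔ ω ∈ Sav := by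
      simp only [hSav, mem_setOf_eq]
      refine forall_congr' fun t => forall_congr' fun _ => forall_congr' fun _ => ?_
      rw [reachable_iff_exists_mem_openEdgeCluster ω v t]
    simp only [hGdef]
    by_cases h : ω ∈ Sav
    · rw [if_pos (hiff.2 h), indicator_of_mem h, Pi.one_apply]
    · rw [if_neg (fun h' => h (hiff.1 h')), indicator_of_notMem h]
  have h2 : μ.real D * μ.real (D ∩ (Ovo ∩ Sav)) ≤ μ.real (D ∩ Ovo) * μ.real (D ∩ Sav) := by
    have key := BHK2006_clusterConditionalPositiveAssociation.antitone_right BHK2006_clusterConditionalPositiveAssociation_holds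
      V w v X (connIndicatorFn v o) G (monotone_connIndicatorFn v o) hG hvX
    simp_rw [hFo, hGω, indicator_one_mul_indicator_one] at key
    rw [KNPreFKG.setIntegral_indicator_one_eq μ D Ovo, KNPreFKG.setIntegral_indicator_one_eq μ D Sav,
      KNPreFKG.setIntegral_indicator_one_eq μ D (Ovo ∩ Sav)] at key
    exact key
  -- the chain
  rw [hT, hOov, hPv]
  have hmono : μ.real (D ∩ Ova ∩ Ovo) ≤ μ.real (openConn o a ∩ ⋂ t ∈ T.filter (fun t => r t < r a), (openConn o t)ᶜ : Set (BondConfig V)) :=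
    measureReal_mono hincl
  have hs1 : D ∩ (Ovo ∩ Ova) = D ∩ Ova ∩ Ovo := by
    ext ω; simp only [mem_inter_iff]; tauto
  have hs2 : D ∩ Sav ∩ Ovo = D ∩ (Ovo ∩ Sav) := by
    ext ω; simp only [mem_inter_iff]; tauto
  rw [hs1] at h1
  rw [hs2]
  rcases (hn D).lt_or_eq with hDpos | hD0
  · -- `μ(D) > 0`: chain (1) and (2) and cancel `μ(D)`
    have step : μ.real D * (μ.real (D ∩ (Ovo ∩ Sav)) * μ.real (D ∩ Ova)) ≤ μ.real D * (μ.real (D ∩ Sav) * μ.real (D ∩ Ova ∩ Ovo)) := by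
      calc μ.real D * (μ.real (D ∩ (Ovo ∩ Sav)) * μ.real (D ∩ Ova))
          = (μ.real D * μ.real (D ∩ (Ovo ∩ Sav))) * μ.real (D ∩ Ova) := by ring
        _ ≤ (μ.real (D ∩ Ovo) * μ.real (D ∩ Sav)) * μ.real (D ∩ Ova) := by gcongr
        _ = μ.real (D ∩ Sav) * (μ.real (D ∩ Ovo) * μ.real (D ∩ Ova)) := by ring
        _ ≤ μ.real (D ∩ Sav) * (μ.real D * μ.real (D ∩ Ova ∩ Ovo)) := by gcongr
        _ = μ.real D * (μ.real (D ∩ Sav) * μ.real (D ∩ Ova ∩ Ovo)) := by ring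
    have step' := le_of_mul_le_mul_left step hDpos
    calc μ.real (D ∩ (Ovo ∩ Sav)) * μ.real (D ∩ Ova)
        ≤ μ.real (D ∩ Sav) * μ.real (D ∩ Ova ∩ Ovo) := step'
      _ ≤ μ.real (D ∩ Sav) * μ.real (openConn o a ∩ ⋂ t ∈ T.filter (fun t => r t < r a), (openConn o t)ᶜ : Set (BondConfig V)) := by
          gcongr
  · -- `μ(D) = 0`: every event inside `D` is null
    have hz : ∀ S : Set (BondConfig V), μ.real (D ∩ S) = 0 := fun S =>
      le_antisymm (hD0 ▸ measureReal_mono inter_subset_left) (hn _)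
    rw [hz, zero_mul]
    exact mul_nonneg (hn _) (hn _)

end CSH

end Summit.CriticalPhenomena.PercolationContinuityZ3.Theorems

end
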